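import Summits.Ventures.LatticeQCDFlow.Scoring.SU2TorusPlaquettePairCharacterIntegral
import Summits.Ventures.LatticeQCDFlow.Scoring.SU2TorusPolyakovLoops
import HarnessLib

/-!
# SU(2) on the 2-torus: the character-expansion term of the two-plaquette insertion

HONEST FRAMING: exact (Metropolis-corrected) sampling algorithms for lattice gauge theory;
figures of merit are autocorrelation/cost numbers at stated couplings and volumes; no
continuum-physics claim.

Venture `LatticeQCDFlow` (cell pub-lqcd), sub-topic `Scoring`; FANOUT row 5 (`s0-sun-a`), GEN-12.
NEW WORK of the cell (placement rule); first of three files typing the EXACT PAIR CORRELATION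
`⟨½ tr U_p · ½ tr U_q⟩_{(ℤ/L)²,β}` of two distinct plaquettes (the covariance term of the error-bar oracle
`Var(P̄)`): `prod_update_update_const` (`∏_p c(x_p) = c_b c_a c_n^{L²−2}` for an assignment constant off two
plaquettes) and `pair_insertion_term_two` (the expansion term `(∏_p c_{x_p}) ∫ a₀(U_{x₀}) a₀(U_{y₀}) ∏_p χ_{x_p}(U_p)`
evaluated by `SU2TorusPlaquettePairCharacterIntegral`).  Series: `SU2TorusPlaquettePairSeries`; the exact
formula and its finite-volume analysis: `SU2TorusPlaquettePairFiniteVolume`.  Nothing is cited; no `def`.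
-/

noncomputable section

open Real MeasureTheory Set Function Finset Polynomial.Chebyshev
open Literature.MathematicalPhysics.QuantumFieldTheory Literature.MathematicalPhysics.QuantumLattice
open Literature.Analysis.FunctionSpaces
open Summit.Ventures.LatticeQCDFlow.Exactness
open Summit.Ventures.LatticeQCDFlow.Theory2.Lattice

namespace Summit.Ventures.LatticeQCDFlow.Scoring

variable {L : ℕ} [NeZero L]

/-! ## §1. The expansion term -/

/-- The product of character coefficients of an assignment constant off two distinct plaquettes:
`∏_p c(update (update (const n) q₀ a) p₀ b) = c_b · c_a · c_n^{L²−2}`. -/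
theorem prod_update_update_const (c : ℕ → ℝ) {p₀ q₀ : Plaquette 2 L} (hpq : p₀ ≠ q₀) (n a b : ℕ) :
    ∏ p : Plaquette 2 L, c (update (update (fun _ : Plaquette 2 L => n) q₀ a) p₀ b p) =
      c b * c a * c n ^ (L ^ 2 - 2) := by
  rw [← Finset.mul_prod_erase _ _ (Finset.mem_univ p₀), update_self]
  have hq : q₀ ∈ Finset.univ.erase p₀ := Finset.mem_erase.mpr ⟨hpq.symm, Finset.mem_univ _⟩
  rw [Finset.prod_congr rfl (fun p hp => by rw [update_of_ne (Finset.ne_of_mem_erase hp)]),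
    ← Finset.mul_prod_erase _ _ hq, update_self, mul_assoc]
  congr 2
  rw [Finset.prod_congr rfl (fun p hp => by rw [update_of_ne (Finset.ne_of_mem_erase hp)]),
    Finset.prod_const, Finset.card_erase_of_mem hq, Finset.card_erase_of_mem (Finset.mem_univ _),
    Finset.card_univ]
  congr 1
  let e : Plaquette 2 L ≃ Site 2 L :=
    { toFun := fun p => p.1
      invFun := fun x => (x, ⟨((0 : Fin 2), (1 : Fin 2)), by decide⟩)
      left_inv := fun p => (plaquette_two_eq p).symm
      right_inv := fun _ => rfl }
  rw [Fintype.card_congr e, Flux.card_site_two]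
  omega

omit [NeZero L] in
/-- The product of two plaquette traces is continuous in the configuration. -/
theorem continuous_su2a0_pair_plaquette (x₀ y₀ : Site 2 L) :
    Continuous fun V : GaugeConfig 2 L (Matrix.specialUnitaryGroup (Fin 2) ℂ) =>
      su2a0 (plaquetteHolonomy V x₀ 0 1) * su2a0 (plaquetteHolonomy V y₀ 0 1) := by
  have h : ∀ z : Site 2 L, Continuous fun V : GaugeConfig 2 L (Matrix.specialUnitaryGroup (Fin 2) ℂ) =>
      su2a0 (plaquetteHolonomy V z 0 1) :=
    fun z => continuous_su2a0.comp (by unfold plaquetteHolonomy; fun_prop)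
  exact (h x₀).mul (h y₀)

/-- **The expansion term of the pair insertion**: for `x : plaquettes → ℕ` with base-site assignment `m`
and `x₀ ≠ y₀`, `(∏_p c_{x_p}) ∫ a₀(U_{x₀}) a₀(U_{y₀}) ∏_p χ_{x_p}(U_p) = (∏_p c_{x_p})·(¼ I(m^{+y+x}) + …)`. -/
theorem pair_insertion_term_two (β : ℝ) {x₀ y₀ : Site 2 L} (hxy : x₀ ≠ y₀) (x : Plaquette 2 L → ℕ) :
    (∏ p, Real.exp (-(2 * β)) * (besselI (x p) (2 * β) - besselI (x p + 2) (2 * β))) *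
        ∫ V, su2a0 (plaquetteHolonomy V x₀ 0 1) * su2a0 (plaquetteHolonomy V y₀ 0 1) *
          ∏ p : Plaquette 2 L, (U ℝ (x p)).eval (su2a0 (plaquetteHolonomy V p.1 p.2.1.1 p.2.1.2))
          ∂(Measure.pi fun _ : Edge 2 L => haarProbability (Matrix.specialUnitaryGroup (Fin 2) ℂ)) =
      (∏ p, Real.exp (-(2 * β)) * (besselI (x p) (2 * β) - besselI (x p + 2) (2 * β))) *
        ((1 / 4) * (if (∀ s : Site 2 L,
              update (update (fun s : Site 2 L => x (s, ⟨((0 : Fin 2), (1 : Fin 2)), by decide⟩)) y₀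
                  (x (y₀, ⟨((0 : Fin 2), (1 : Fin 2)), by decide⟩) + 1)) x₀
                  (x (x₀, ⟨((0 : Fin 2), (1 : Fin 2)), by decide⟩) + 1) s =
                update (update (fun s : Site 2 L => x (s, ⟨((0 : Fin 2), (1 : Fin 2)), by decide⟩)) y₀
                  (x (y₀, ⟨((0 : Fin 2), (1 : Fin 2)), by decide⟩) + 1)) x₀
                  (x (x₀, ⟨((0 : Fin 2), (1 : Fin 2)), by decide⟩) + 1) 0) then
            ((((update (update (fun s : Site 2 L => x (s, ⟨((0 : Fin 2), (1 : Fin 2)), by decide⟩)) y₀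
                (x (y₀, ⟨((0 : Fin 2), (1 : Fin 2)), by decide⟩) + 1)) x₀
                (x (x₀, ⟨((0 : Fin 2), (1 : Fin 2)), by decide⟩) + 1) 0 : ℕ) : ℝ) + 1) ^ (L ^ 2))⁻¹ else 0) +
          (1 / 4) * (if x (x₀, ⟨((0 : Fin 2), (1 : Fin 2)), by decide⟩) = 0 then 0 else
            if (∀ s : Site 2 L,
                update (update (fun s : Site 2 L => x (s, ⟨((0 : Fin 2), (1 : Fin 2)), by decide⟩)) y₀
                    (x (y₀, ⟨((0 : Fin 2), (1 : Fin 2)), by decide⟩) + 1)) x₀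
                    (x (x₀, ⟨((0 : Fin 2), (1 : Fin 2)), by decide⟩) - 1) s =
                  update (update (fun s : Site 2 L => x (s, ⟨((0 : Fin 2), (1 : Fin 2)), by decide⟩)) y₀
                    (x (y₀, ⟨((0 : Fin 2), (1 : Fin 2)), by decide⟩) + 1)) x₀
                    (x (x₀, ⟨((0 : Fin 2), (1 : Fin 2)), by decide⟩) - 1) 0) then
              ((((update (update (fun s : Site 2 L => x (s, ⟨((0 : Fin 2), (1 : Fin 2)), by decide⟩)) y₀
                  (x (y₀, ⟨((0 : Fin 2), (1 : Fin 2)), by decide⟩) + 1)) x₀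
                  (x (x₀, ⟨((0 : Fin 2), (1 : Fin 2)), by decide⟩) - 1) 0 : ℕ) : ℝ) + 1) ^ (L ^ 2))⁻¹ else 0) +
          (1 / 4) * (if x (y₀, ⟨((0 : Fin 2), (1 : Fin 2)), by decide⟩) = 0 then 0 else
            ((if (∀ s : Site 2 L,
                update (update (fun s : Site 2 L => x (s, ⟨((0 : Fin 2), (1 : Fin 2)), by decide⟩)) y₀
                    (x (y₀, ⟨((0 : Fin 2), (1 : Fin 2)), by decide⟩) - 1)) x₀
                    (x (x₀, ⟨((0 : Fin 2), (1 : Fin 2)), by decide⟩) + 1) s =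
                  update (update (fun s : Site 2 L => x (s, ⟨((0 : Fin 2), (1 : Fin 2)), by decide⟩)) y₀
                    (x (y₀, ⟨((0 : Fin 2), (1 : Fin 2)), by decide⟩) - 1)) x₀
                    (x (x₀, ⟨((0 : Fin 2), (1 : Fin 2)), by decide⟩) + 1) 0) then
              ((((update (update (fun s : Site 2 L => x (s, ⟨((0 : Fin 2), (1 : Fin 2)), by decide⟩)) y₀
                  (x (y₀, ⟨((0 : Fin 2), (1 : Fin 2)), by decide⟩) - 1)) x₀
                  (x (x₀, ⟨((0 : Fin 2), (1 : Fin 2)), by decide⟩) + 1) 0 : ℕ) : ℝ) + 1) ^ (L ^ 2))⁻¹ else 0) +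
            (if x (x₀, ⟨((0 : Fin 2), (1 : Fin 2)), by decide⟩) = 0 then 0 else
              if (∀ s : Site 2 L,
                  update (update (fun s : Site 2 L => x (s, ⟨((0 : Fin 2), (1 : Fin 2)), by decide⟩)) y₀
                      (x (y₀, ⟨((0 : Fin 2), (1 : Fin 2)), by decide⟩) - 1)) x₀
                      (x (x₀, ⟨((0 : Fin 2), (1 : Fin 2)), by decide⟩) - 1) s =
                    update (update (fun s : Site 2 L => x (s, ⟨((0 : Fin 2), (1 : Fin 2)), by decide⟩)) y₀
                      (x (y₀, ⟨((0 : Fin 2), (1 : Fin 2)), by decide⟩) - 1)) x₀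
                      (x (x₀, ⟨((0 : Fin 2), (1 : Fin 2)), by decide⟩) - 1) 0) then
                ((((update (update (fun s : Site 2 L => x (s, ⟨((0 : Fin 2), (1 : Fin 2)), by decide⟩)) y₀
                    (x (y₀, ⟨((0 : Fin 2), (1 : Fin 2)), by decide⟩) - 1)) x₀
                    (x (x₀, ⟨((0 : Fin 2), (1 : Fin 2)), by decide⟩) - 1) 0 : ℕ) : ℝ) + 1) ^ (L ^ 2))⁻¹
                else 0)))) := by
  congr 1
  have hint : (fun V : GaugeConfig 2 L (Matrix.specialUnitaryGroup (Fin 2) ℂ) =>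
      su2a0 (plaquetteHolonomy V x₀ 0 1) * su2a0 (plaquetteHolonomy V y₀ 0 1) *
        ∏ p : Plaquette 2 L, (U ℝ (x p)).eval (su2a0 (plaquetteHolonomy V p.1 p.2.1.1 p.2.1.2))) =
      fun V => su2a0 (plaquetteHolonomy V x₀ 0 1) * (su2a0 (plaquetteHolonomy V y₀ 0 1) *
        ∏ s : Site 2 L, (U ℝ ((fun s : Site 2 L => x (s, ⟨((0 : Fin 2), (1 : Fin 2)), by decide⟩)) s)).eval
          (su2a0 (plaquetteHolonomy V s 0 1))) := by
    funext V
    rw [prod_plaquette_two, mul_assoc]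
  rw [hint, integral_su2a0_mul_su2a0_mul_prod_su2Character_plaquettes _ hxy]

end Summit.Ventures.LatticeQCDFlow.Scoring
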